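import Mathlib
import Summits.NavierStokesRegularity.NavierStokesRegularity.Theorems.ThreadingFluxHorizonTowerZonalDescent
import HarnessLib

/-!
# Crux `PoloidalLiouville` (stmt-NavierStokesRegularity-1222, W1/W2), crux idea «linear-loop-law» (ns-idea-15):
# K-alg ALL DEGREES, kernel part 1 — PAIR TOOLS in the complex coordinates `(W, V, Z)`: linearity of `tripleC`, its bilinear
# TOP COMPONENT, the mirror on weights, ONE-DIMENSIONAL harmonic weight slots, jets without side conditions

Support file (Theorems-side tooling; seat ns-wall-eng-3 g3, cell ns-wall-extremal, W1 adjunct; `--supports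
stmt-NavierStokesRegularity-1222`, helper).  Setting = ns-wall-eng-5 g4's complex-coordinate algebra
(`ThreadingFluxHorizonTowerZonalAlgebra/Slot/Descent.lean`: `CPoly = ℂ[W,V,Z]`, azimuthal weight `wt`, `lapC`, `lam`,
`tripleC A B = B_Z ΛA − A_Z ΛB + 2Z(A_V B_W − A_W B_V) = −i·det(∇A, ∇B, x)`, slot exponents `sx`, recursion (1.2), jets, weight
bounds `WB`, mirror).  NEW here (pure polynomial algebra, uniform in the degree):

* `tripleC_self/_swap/_add_*/_C_mul_right`, `lapC_sub_C_mul` — (bi)linearity and antisymmetry;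
* `wcomp_tripleC_top` — if all weights of `P` are `≤ β` and of `Q` are `≤ γ`, the weight-`(β+γ)` component of `tripleC P Q` is
  `tripleC P_β Q_γ`;
* `isWeightedHomogeneous_mirror`, `coeff_tri_mirror`, `mirror_mirror` — the `W ↔ V` mirror negates pure weights;
* ★ `slot_proportional` — a `Δ̃`-harmonic weight slot of fixed degree is ONE-dimensional (recursion (1.2) + mirror);
* `jet_val`, `jet_d0'`, `jet_d2'`, `slot_recursion_zero` — axis-point jets and the `k = 0` recursion with no side conditions.

Used by `ThreadingFluxLoopLawBracketSlotPair.lean` (slot-pair identity, pair rigidity) and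
`ThreadingFluxLoopLawSameDegreeBracketRigidity.lean` (`SameDegreeBracketRigidity`, LoopLawSketch l.107, ALL `l`).  HONEST LABEL:
finite-dimensional algebra about one crux idea's typed objects; `PoloidalLiouville` (1222), `UnthreadedRigidity` (27585) and NS
regularity remain OPEN; W1/W2 movement 0.  [folklore]
-/

-- the summit and its single problem share the name (D-0017 nested layout)
set_option linter.dupNamespace false

noncomputable section

open MvPolynomial Finsupp

namespace Summit.NavierStokesRegularity.NavierStokesRegularity.Theorems.PoloidalLiouville.HorizonTower.Zonal

/-! ### Linearity and symmetry of `tripleC`, `lapC` -/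

section Linear

variable (P Q R : CPoly) (c : ℂ)

/-- `tripleC` is alternating. [folklore] -/
theorem tripleC_self : tripleC P P = 0 := by unfold tripleC; ring

/-- `tripleC` is antisymmetric. [folklore] -/
theorem tripleC_swap : tripleC Q P = -tripleC P Q := by unfold tripleC; ring

/-- `tripleC` is additive in the second slot. [folklore] -/
theorem tripleC_add_right : tripleC P (Q + R) = tripleC P Q + tripleC P R := by
  unfold tripleC lam; simp only [map_add]; ring

/-- `tripleC` is additive in the first slot. [folklore] -/
theorem tripleC_add_left : tripleC (P + Q) R = tripleC P R + tripleC Q R := by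
  unfold tripleC lam; simp only [map_add]; ring

/-- `tripleC` commutes with scalars in the second slot. [folklore] -/
theorem tripleC_C_mul_right : tripleC P (C c * Q) = C c * tripleC P Q := by
  unfold tripleC lam; simp only [pderiv_C_mul]; ring

/-- `tripleC` respects subtraction of a multiple in the second slot. [folklore] -/
theorem tripleC_sub_C_mul_right : tripleC P (Q - C c * R) = tripleC P Q - C c * tripleC P R := by
  unfold tripleC lam; simp only [map_sub, pderiv_C_mul]; ring

/-- `Δ̃` respects subtraction of a multiple. [folklore] -/
theorem lapC_sub_C_mul : lapC (Q - C c * R) = lapC Q - C c * lapC R := by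
  unfold lapC; simp only [map_sub, pderiv_C_mul]; ring

end Linear

/-! ### The bilinear top component of `tripleC` -/

section Top

variable {P Q : CPoly} {β γ : ℤ}

/-- **Top component of the triple product**: if all weights of `P` are `≤ β` and all weights of `Q` are `≤ γ`, the weight-`(β+γ)`
component of `tripleC P Q` is `tripleC P_β Q_γ`. -/
theorem wcomp_tripleC_top (hP : WB β P) (hQ : WB γ Q) :
    weightedHomogeneousComponent wt (β + γ) (tripleC P Q)
      = tripleC (weightedHomogeneousComponent wt β P) (weightedHomogeneousComponent wt γ Q) := by
  set A := weightedHomogeneousComponent wt β P with hA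
  set B := weightedHomogeneousComponent wt γ Q with hB
  set R := P - A with hR
  set S := Q - B with hS
  have hAw : IsWeightedHomogeneous wt A β := weightedHomogeneousComponent_isWeightedHomogeneous β P
  have hBw : IsWeightedHomogeneous wt B γ := weightedHomogeneousComponent_isWeightedHomogeneous γ Q
  have hAb : WB β A := WB.of_isWeightedHomogeneous hAw
  have hBb : WB γ B := WB.of_isWeightedHomogeneous hBw
  have hRb : WB (β - 1) R := hP.sub_wcomp
  have hSb : WB (γ - 1) S := hQ.sub_wcomp
  have hPQ : tripleC P Q = tripleC A B + (tripleC A S + tripleC R B + tripleC R S) := by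
    have hP' : P = A + R := by rw [hR]; ring
    have hQ' : Q = B + S := by rw [hS]; ring
    rw [hP', hQ', tripleC_add_left, tripleC_add_right, tripleC_add_right]; ring
  have hE : WB (β + γ - 1) (tripleC A S + tripleC R B + tripleC R S) := by
    refine (WB.add (WB.add ?_ ?_) ?_)
    · convert wb_tripleC hAb hSb using 1; ring
    · convert wb_tripleC hRb hBb using 1; ring
    · exact (wb_tripleC hRb hSb).mono (by omega)
  rw [hPQ, map_add, wcomp_eq_zero_of_WB hE (by omega), add_zero]
  exact (isWeightedHomogeneous_tripleC hAw hBw).weightedHomogeneousComponent_same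

end Top

/-! ### The mirror on exponents and weights -/

section Mirror

/-- The mirror swaps the `W`- and `V`-exponents. [folklore] -/
theorem mapDomain_swap_tri (a b c : ℕ) : (tri a b c).mapDomain (Equiv.swap (0 : Fin 3) 1) = tri b a c := by
  have h0 : ((tri a b c).mapDomain (Equiv.swap (0 : Fin 3) 1)) 0 = (tri a b c) 1 := by
    have h := Finsupp.mapDomain_apply (Equiv.swap (0 : Fin 3) 1).injective (tri a b c) 1
    rwa [Equiv.swap_apply_right] at h
  have h1 : ((tri a b c).mapDomain (Equiv.swap (0 : Fin 3) 1)) 1 = (tri a b c) 0 := by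
    have h := Finsupp.mapDomain_apply (Equiv.swap (0 : Fin 3) 1).injective (tri a b c) 0
    rwa [Equiv.swap_apply_left] at h
  have h2 : ((tri a b c).mapDomain (Equiv.swap (0 : Fin 3) 1)) 2 = (tri a b c) 2 := by
    have h := Finsupp.mapDomain_apply (Equiv.swap (0 : Fin 3) 1).injective (tri a b c) 2
    rwa [show (Equiv.swap (0 : Fin 3) 1) 2 = 2 by decide] at h
  rw [eq_tri ((tri a b c).mapDomain (Equiv.swap (0 : Fin 3) 1)), h0, h1, h2, tri_apply_zero, tri_apply_one, tri_apply_two]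

/-- The mirror is an involution. [folklore] -/
theorem mirror_mirror (P : CPoly) : mirror (mirror P) = P := by
  rw [mirror, rename_rename]
  have : ((Equiv.swap (0 : Fin 3) 1) ∘ (Equiv.swap (0 : Fin 3) 1)) = id := by
    funext i; simp [Equiv.swap_apply_self]
  rw [this, rename_id]
  rfl

/-- The mirror is injective. [folklore] -/
theorem mirror_eq_zero_iff (P : CPoly) : mirror P = 0 ↔ P = 0 := by
  constructor
  · intro h
    have := congrArg mirror h
    rwa [mirror_mirror, map_zero] at this
  · intro h; rw [h, map_zero]

/-- Coefficients of the mirror image, `tri` form. [folklore] -/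
theorem coeff_tri_mirror (a b c : ℕ) (P : CPoly) : coeff (tri b a c) (mirror P) = coeff (tri a b c) P := by
  rw [← mapDomain_swap_tri, coeff_mirror]

/-- The mirror negates the azimuthal weight of a weight-homogeneous polynomial. [folklore] -/
theorem isWeightedHomogeneous_mirror {P : CPoly} {μ : ℤ} (h : IsWeightedHomogeneous wt P μ) :
    IsWeightedHomogeneous wt (mirror P) (-μ) := by
  intro d hd
  have hd' : coeff (tri (d 1) (d 0) (d 2)) P ≠ 0 := by
    rw [eq_tri d, coeff_tri_mirror] at hd; exact hd
  have hw := h hd'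
  rw [weight_wt_tri] at hw
  rw [weight_wt]
  omega

end Mirror

/-! ### Harmonic weight slots are one-dimensional -/

section OneDim

variable {X Y : CPoly} {M dd : ℕ}

/-- A non-zero harmonic slot has a non-zero leading coefficient `a₀ = coeff (W^M Z^dd)`. -/
theorem coeff_sx_zero_ne_zero (hW : IsWeightedHomogeneous wt X (M : ℤ)) (hX : X.IsHomogeneous (M + dd))
    (hlap : lapC X = 0) (hX0 : X ≠ 0) : coeff (sx M dd 0) X ≠ 0 :=
  fun h => hX0 (slot_eq_zero_of_coeff_zero hW hX hlap h)

/-- **One-dimensional slots** (non-negative weight): two `Δ̃`-harmonic polynomials of weight `M` and degree `M + dd`, the first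
non-zero, are proportional. -/
theorem slot_proportional_nat (hXw : IsWeightedHomogeneous wt X (M : ℤ)) (hXh : X.IsHomogeneous (M + dd)) (hXl : lapC X = 0)
    (hX0 : X ≠ 0) (hYw : IsWeightedHomogeneous wt Y (M : ℤ)) (hYh : Y.IsHomogeneous (M + dd)) (hYl : lapC Y = 0) :
    ∃ c : ℂ, Y = C c * X := by
  have ha : coeff (sx M dd 0) X ≠ 0 := coeff_sx_zero_ne_zero hXw hXh hXl hX0
  set c : ℂ := coeff (sx M dd 0) Y / coeff (sx M dd 0) X with hc
  refine ⟨c, ?_⟩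
  have hDw : IsWeightedHomogeneous wt (Y - C c * X) (M : ℤ) := isWeightedHomogeneous_sub hYw (hXw.C_mul c)
  have hDh : (Y - C c * X).IsHomogeneous (M + dd) := hYh.sub (hXh.C_mul c)
  have hDl : lapC (Y - C c * X) = 0 := by rw [lapC_sub_C_mul, hXl, hYl, mul_zero, sub_zero]
  have hD0 : coeff (sx M dd 0) (Y - C c * X) = 0 := by
    rw [coeff_sub, coeff_C_mul, hc, div_mul_cancel₀ _ ha, sub_self]
  have := slot_eq_zero_of_coeff_zero hDw hDh hDl hD0
  exact sub_eq_zero.mp this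

/-- Degree bound: a non-zero polynomial of weight `μ` and degree `l` has `|μ| ≤ l`; in particular `μ.toNat ≤ l`. [folklore] -/
theorem weight_le_degree {μ : ℤ} {l : ℕ} (hw : IsWeightedHomogeneous wt X μ) (hX : X.IsHomogeneous l) (hX0 : X ≠ 0) :
    -(l : ℤ) ≤ μ ∧ μ ≤ l := by
  obtain ⟨d, hd⟩ := exists_coeff_ne_zero hX0
  obtain ⟨h1, h2⟩ := exponent_of_mem_support hw hX (MvPolynomial.mem_support_iff.mpr hd)
  omega

/-- **One-dimensional slots** (any integer weight): two `Δ̃`-harmonic polynomials of the same weight `μ` and degree `l`, the first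
non-zero, are proportional (negative weights through the mirror). -/
theorem slot_proportional {μ : ℤ} {l : ℕ} (hXw : IsWeightedHomogeneous wt X μ) (hXh : X.IsHomogeneous l) (hXl : lapC X = 0)
    (hX0 : X ≠ 0) (hYw : IsWeightedHomogeneous wt Y μ) (hYh : Y.IsHomogeneous l) (hYl : lapC Y = 0) :
    ∃ c : ℂ, Y = C c * X := by
  obtain ⟨hlo, hhi⟩ := weight_le_degree hXw hXh hX0
  rcases le_or_gt 0 μ with hμ | hμ
  · -- non-negative weight: `μ = M`, `l = M + dd`
    obtain ⟨M, rfl⟩ : ∃ M : ℕ, μ = M := ⟨μ.toNat, (Int.toNat_of_nonneg hμ).symm⟩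
    obtain ⟨dd, rfl⟩ : ∃ dd : ℕ, l = M + dd := ⟨l - M, by omega⟩
    exact slot_proportional_nat hXw hXh hXl hX0 hYw hYh hYl
  · -- negative weight: mirror
    obtain ⟨M, hM⟩ : ∃ M : ℕ, -μ = M := ⟨(-μ).toNat, (Int.toNat_of_nonneg (by omega)).symm⟩
    obtain ⟨dd, rfl⟩ : ∃ dd : ℕ, l = M + dd := ⟨l - M, by omega⟩
    have hXw' : IsWeightedHomogeneous wt (mirror X) (M : ℤ) := hM ▸ isWeightedHomogeneous_mirror hXw
    have hYw' : IsWeightedHomogeneous wt (mirror Y) (M : ℤ) := hM ▸ isWeightedHomogeneous_mirror hYw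
    have hXl' : lapC (mirror X) = 0 := by rw [mirror_lapC, hXl, map_zero]
    have hYl' : lapC (mirror Y) = 0 := by rw [mirror_lapC, hYl, map_zero]
    have hX0' : mirror X ≠ 0 := fun h => hX0 ((mirror_eq_zero_iff X).mp h)
    obtain ⟨c, hc⟩ := slot_proportional_nat hXw' hXh.rename_isHomogeneous hXl' hX0' hYw' hYh.rename_isHomogeneous hYl'
    refine ⟨c, ?_⟩
    have := congrArg mirror hc
    rwa [mirror_mirror, map_mul, mirror_mirror, show mirror (C c) = C c from rename_C _ _] at this

end OneDim

/-! ### Jets without side conditions and the recursion at `k = 0` -/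

section Jets2

variable {A : CPoly} {M dd : ℕ}

/-- Jet `A(1,0,1) = a₀`. [folklore] -/
theorem jet_val (hW : IsWeightedHomogeneous wt A (M : ℤ)) (hA : A.IsHomogeneous (M + dd)) :
    eval axisPt A = coeff (sx M dd 0) A := by
  rw [eval_axisPt_nat hW hA]
  have ex : tri M 0 (M + dd - M) = sx M dd 0 := by rw [sx, tri_eq_tri_iff]; omega
  rw [ex]

/-- Jet `∂_W A(1,0,1) = M·a₀`, all `M`. [folklore] -/
theorem jet_d0' (hW : IsWeightedHomogeneous wt A (M : ℤ)) (hA : A.IsHomogeneous (M + dd)) :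
    eval axisPt (pderiv 0 A) = (M : ℂ) * coeff (sx M dd 0) A := by
  rcases Nat.eq_zero_or_pos M with rfl | hM
  · have hw : IsWeightedHomogeneous wt (pderiv 0 A) (-1 : ℤ) := by
      convert isWeightedHomogeneous_pderiv_zero hW using 2
      simp
    rw [eval_axisPt_neg hw hA.pderiv (by norm_num)]; push_cast; ring
  · exact jet_d0 hW hA hM

/-- Jet `∂_Z A(1,0,1) = dd·a₀`, all `dd`. [folklore] -/
theorem jet_d2' (hW : IsWeightedHomogeneous wt A (M : ℤ)) (hA : A.IsHomogeneous (M + dd)) :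
    eval axisPt (pderiv 2 A) = (dd : ℂ) * coeff (sx M dd 0) A := by
  rcases Nat.eq_zero_or_pos dd with rfl | hdd
  · rw [eval_axisPt_nat (isWeightedHomogeneous_pderiv_two hW) hA.pderiv, coeff_pderiv, tri_add_single_two, tri_apply_two]
    have hz : coeff (tri M 0 (M + 0 - 1 - M + 1)) A = 0 := hA.coeff_eq_zero (by rw [degree_tri]; omega)
    rw [hz]; push_cast; ring
  · exact jet_d2 hW hA hdd

/-- Recursion (1.2) at `k = 0` in a form valid for every `dd`: `4(M+1)·a₁ + (dd−1)dd·a₀ = 0`. -/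
theorem slot_recursion_zero (hA : A.IsHomogeneous (M + dd)) (hlap : lapC A = 0) :
    4 * ((M : ℂ) + 1) * coeff (sx M dd 1) A + ((dd : ℂ) - 1) * dd * coeff (sx M dd 0) A = 0 := by
  rcases Nat.lt_or_ge dd 2 with h | h
  · have hz : coeff (sx M dd 1) A = 0 := coeff_sx_eq_zero_of_lt hA (by omega)
    rw [hz]
    interval_cases dd <;> push_cast <;> ring
  · have h0 := slot_recursion (M := M) (dd := dd) (A := A) hlap (k := 0) (by omega)
    simp only [Nat.cast_zero, add_zero, mul_zero, sub_zero, zero_add] at h0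
    linear_combination h0

end Jets2

end Summit.NavierStokesRegularity.NavierStokesRegularity.Theorems.PoloidalLiouville.HorizonTower.Zonal

end
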